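import Summits.CriticalPhenomena.PercolationContinuityZ3.Theorems.SahiBoxTP2FourFunctions
import Summits.CriticalPhenomena.PercolationContinuityZ3.Theorems.SahiBoxTP2LocalApproximation

/-!
# Holley's inequality in infinite volume, density-free: local Gibbs modifications of a box-TP₂ spin law
# (e.g. of the Ising states `μ⁺`, `μ⁻`, `μ^∅`) satisfying Holley's condition are stochastically ordered

Support file of the Sahi cell (`prim-sahi`, typer seat, generation 15; `--supports stmt-CriticalPhenomena-4575`).
Theorems only (no definitions, no named facts, no sorries).  Instance of the density-free four functions theorem
(`SahiBoxTP2FourFunctions.fourFunctions_of_fiber`) on `{−1,+1}^ι`, with the window truncations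
`σ ↦ (σ on J, + off J)` as discretisation scheme: these are measurable lattice homomorphisms with finite range
whose fibres are the window cylinders — closed boxes — so the fibre TP₂ condition IS the cell's `IsBoxTP2`.

* `glue_restrict_inf/sup`, `finite_range_glue_restrict`, `preimage_glue_restrict_singleton_of_eq/ne`,
  `IsBoxTP2.fiber_glue_restrict_mul_le` — the scheme and its TP₂ fibres.
* `IsBoxTP2.holley_integral_local` — **Holley's inequality with weights for a finite box-TP₂ measure on
  `{−1,+1}^ι`**: for LOCAL nonnegative `g₁, g₂` with the cross condition `g₁(σ)g₂(τ) ≤ g₁(σ ∧ τ)g₂(σ ∨ τ)` (neither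
  weight need be log-supermodular) and a local bounded increasing `h ≥ 0`:
  `(∫ g₁h dμ)(∫ g₂ dμ) ≤ (∫ g₁ dμ)(∫ g₂h dμ)`.
* `IsBoxTP2.holley_integral_spinConfig` — the same for EVERY bounded measurable increasing `h` of the infinite
  configuration (`ι` countably infinite, `μ` a probability measure): the martingale approximation theorem
  `IsBoxTP2.exists_local_monotone_tendsto_ae` (generation 15) + dominated convergence; `…_upperSet` (events).
* `IsBoxTP2.gibbs_holley_spinConfig` — **HOLLEY'S THEOREM FOR LOCAL GIBBS MODIFICATIONS OF A BOX-TP₂ LAW**: for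
  local energies `H₁, H₂` with Holley's condition `H₁(σ ∧ τ) + H₂(σ ∨ τ) ≤ H₁(σ) + H₂(τ)`, the perturbed laws
  `e^{−H₁}μ/Z₁ ≤_st e^{−H₂}μ/Z₂`: `(∫ e^{−H₁}f)(∫ e^{−H₂}) ≤ (∫ e^{−H₁})(∫ e^{−H₂}f)` for every bounded measurable
  increasing `f`; `IsBoxTP2.gibbs_field_mono_spinConfig` — a submodular local `H` perturbed by an increasing local
  term `−m`: `⟨f⟩_{H} ≤ ⟨f⟩_{H−m}` (the perturbed state increases with the field).
* THE ISING STATES (`d ≥ 1`, `β ≥ 0`; plus/minus state any `h`, free state `h ≥ 0`):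
  `plusState_gibbs_holley`, `minusState_gibbs_holley`, `freeState_gibbs_holley` — **local Gibbs modifications
  of the infinite-volume states satisfying Holley's condition are stochastically ordered, for all bounded
  measurable increasing observables** (finite volume, strictly positive weights: Holley 1974, Preston 1974,
  Grimmett RCM Thm. 2.1 / tree `HolleyCriterion.lean`; the infinite-volume density-free statement relative to a
  box-TP₂ base is the cell's).

No sorries, no new axioms.
-/

noncomputable section

namespace Summit.CriticalPhenomena.PercolationContinuityZ3.Theorems.SahiBoxTP2

open MeasureTheory ProbabilityTheory Set Filter Topology Function
open Literature.Probability.LatticeModels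
open scoped ENNReal

/-! ### The window truncation scheme on `{−1,+1}^ι` -/

section Scheme

variable {ι : Type*}

/-- Window truncation commutes with `∧`. [folklore] -/
theorem glue_restrict_inf [DecidableEq ι] (J : Finset ι) (σ τ : ι → ℤˣ) :
    glue J (J.restrict (σ ⊓ τ)) .plus = glue J (J.restrict σ) .plus ⊓ glue J (J.restrict τ) .plus := by
  rw [show J.restrict (σ ⊓ τ) = J.restrict σ ⊓ J.restrict τ from rfl, glue_inf]

/-- Window truncation commutes with `∨`. [folklore] -/
theorem glue_restrict_sup [DecidableEq ι] (J : Finset ι) (σ τ : ι → ℤˣ) :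
    glue J (J.restrict (σ ⊔ τ)) .plus = glue J (J.restrict σ) .plus ⊔ glue J (J.restrict τ) .plus := by
  rw [show J.restrict (σ ⊔ τ) = J.restrict σ ⊔ J.restrict τ from rfl, glue_sup]

/-- Window truncation has finite range. [folklore] -/
theorem finite_range_glue_restrict (J : Finset ι) :
    (range fun σ : ι → ℤˣ => glue J (J.restrict σ) .plus).Finite :=
  (Set.finite_range fun η : ↥J → ℤˣ => glue J η .plus).subset
    (range_comp_subset_range (fun σ : ι → ℤˣ => J.restrict σ) fun η => glue J η .plus)

/-- Window truncation is measurable. [folklore] -/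
theorem measurable_glue_restrict [Countable ι] (J : Finset ι) :
    Measurable fun σ : ι → ℤˣ => glue J (J.restrict σ) .plus :=
  (measurable_of_countable fun η : ↥J → ℤˣ => glue J η .plus).comp
    (Finset.measurable_restrict (X := fun _ : ι => ℤˣ) J)

/-- Restricting a glued configuration to its window returns the pattern. [folklore] -/
theorem restrict_glue (J : Finset ι) (η : ↥J → ℤˣ) (bc : BoundaryCondition ι) : J.restrict (glue J η bc) = η := by
  funext j
  exact glue_apply_of_mem J η bc j.2

/-- **The fibre of window truncation over a point of its range is the window cylinder.** [folklore] -/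
theorem preimage_glue_restrict_singleton_of_eq (J : Finset ι) {a : ι → ℤˣ} (ha : glue J (J.restrict a) .plus = a) :
    (fun σ : ι → ℤˣ => glue J (J.restrict σ) .plus) ⁻¹' {a} = (fun σ : ι → ℤˣ => J.restrict σ) ⁻¹' {J.restrict a} := by
  ext σ
  simp only [mem_preimage, mem_singleton_iff]
  constructor
  · intro h
    have := congrArg (fun τ : ι → ℤˣ => J.restrict τ) h
    simpa only [restrict_glue] using this
  · intro h
    rw [h, ha]

/-- The fibre of window truncation over a point off its range is empty. [folklore] -/
theorem preimage_glue_restrict_singleton_of_ne (J : Finset ι) {a : ι → ℤˣ} (ha : glue J (J.restrict a) .plus ≠ a) :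
    (fun σ : ι → ℤˣ => glue J (J.restrict σ) .plus) ⁻¹' {a} = ∅ := by
  ext σ
  simp only [mem_preimage, mem_singleton_iff, mem_empty_iff_false, iff_false]
  intro h
  apply ha
  have := congrArg (fun τ : ι → ℤˣ => J.restrict τ) h
  rw [restrict_glue] at this
  rw [← this, h]

/-- A local function is invariant under truncation outside its window. [folklore] -/
theorem apply_glue_restrict_of_dependsOn {J : Finset ι} {f : (ι → ℤˣ) → ℝ} (hf : DependsOn f (↑J : Set ι))
    (σ : ι → ℤˣ) : f (glue J (J.restrict σ) .plus) = f σ :=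
  hf fun _ hi => glue_apply_of_mem J _ _ (Finset.mem_coe.1 hi)

/-- A local real function on `{−1,+1}^ι` is bounded. [folklore] -/
theorem exists_abs_le_of_dependsOn {Λ : Finset ι} {H : (ι → ℤˣ) → ℝ} (hH : DependsOn H (↑Λ : Set ι)) :
    ∃ M, ∀ σ, |H σ| ≤ M := by
  have hfin : (range H).Finite := by
    rw [eq_comp_restrict_of_dependsOn Λ hH]
    exact (Set.finite_range fun x : ↥Λ → ℤˣ => H (glue Λ x .plus)).subset (range_comp_subset_range _ _)
  obtain ⟨M, hM⟩ := (hfin.image fun t => |t|).bddAbove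
  exact ⟨M, fun σ => hM (mem_image_of_mem _ (mem_range_self σ))⟩

/-- A local real function on `{−1,+1}^ι` is measurable. [folklore] -/
theorem measurable_of_dependsOn {Λ : Finset ι} {H : (ι → ℤˣ) → ℝ} (hH : DependsOn H (↑Λ : Set ι)) :
    Measurable H := by
  rw [eq_comp_restrict_of_dependsOn Λ hH]
  exact (measurable_of_countable _).comp (Finset.measurable_restrict (X := fun _ : ι => ℤˣ) Λ)

/-- **The fibres of window truncation are TP₂ under a box-TP₂ law** (they are the closed boxes
`[glue η −, glue η +]`, and truncation commutes with `∧`, `∨`). [this work] -/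
theorem IsBoxTP2.fiber_glue_restrict_mul_le [DecidableEq ι] (μ : Measure (ι → ℤˣ)) (hμ : IsBoxTP2 μ)
    (J : Finset ι) (a b : ι → ℤˣ) :
    μ ((fun σ : ι → ℤˣ => glue J (J.restrict σ) .plus) ⁻¹' {a}) *
        μ ((fun σ : ι → ℤˣ => glue J (J.restrict σ) .plus) ⁻¹' {b}) ≤
      μ ((fun σ : ι → ℤˣ => glue J (J.restrict σ) .plus) ⁻¹' {a ⊓ b}) *
        μ ((fun σ : ι → ℤˣ => glue J (J.restrict σ) .plus) ⁻¹' {a ⊔ b}) := by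
  by_cases ha : glue J (J.restrict a) .plus = a
  · by_cases hb : glue J (J.restrict b) .plus = b
    · have hab : glue J (J.restrict (a ⊓ b)) .plus = a ⊓ b := by rw [glue_restrict_inf, ha, hb]
      have hab' : glue J (J.restrict (a ⊔ b)) .plus = a ⊔ b := by rw [glue_restrict_sup, ha, hb]
      rw [preimage_glue_restrict_singleton_of_eq J ha, preimage_glue_restrict_singleton_of_eq J hb,
        preimage_glue_restrict_singleton_of_eq J hab, preimage_glue_restrict_singleton_of_eq J hab',
        restrict_preimage_singleton_eq_Icc, restrict_preimage_singleton_eq_Icc, restrict_preimage_singleton_eq_Icc,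
        restrict_preimage_singleton_eq_Icc, show J.restrict (a ⊓ b) = J.restrict a ⊓ J.restrict b from rfl,
        show J.restrict (a ⊔ b) = J.restrict a ⊔ J.restrict b from rfl, glue_inf, glue_inf, glue_sup, glue_sup]
      exact hμ _ _ _ _
    · rw [preimage_glue_restrict_singleton_of_ne J hb, measure_empty, mul_zero]
      exact zero_le
  · rw [preimage_glue_restrict_singleton_of_ne J ha, measure_empty, zero_mul]
    exact zero_le

end Scheme

/-! ### Holley's inequality with weights on `{−1,+1}^ι` -/

section Holley

variable {ι : Type*} [Countable ι]

/-- **Holley's inequality with weights for a finite box-TP₂ measure on `{−1,+1}^ι`, local version**: `g₁, g₂, h`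
depending on a finite window `J`, nonnegative and bounded, `h` increasing, with the cross condition
`g₁(σ)g₂(τ) ≤ g₁(σ ∧ τ)g₂(σ ∨ τ)`: `(∫ g₁h dμ)(∫ g₂ dμ) ≤ (∫ g₁ dμ)(∫ g₂h dμ)`. [this work] -/
theorem IsBoxTP2.holley_integral_local (μ : Measure (ι → ℤˣ)) [IsFiniteMeasure μ] (hμ : IsBoxTP2 μ)
    (J : Finset ι) {g₁ g₂ h : (ι → ℤˣ) → ℝ} (hg₁d : DependsOn g₁ (↑J : Set ι)) (hg₂d : DependsOn g₂ (↑J : Set ι))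
    (hhd : DependsOn h (↑J : Set ι)) (hg₁0 : ∀ x, 0 ≤ g₁ x) (hg₂0 : ∀ x, 0 ≤ g₂ x) (hh0 : ∀ x, 0 ≤ h x)
    (hg₁m : Measurable g₁) (hg₂m : Measurable g₂) (hhm : Measurable h) {C : ℝ} (hg₁C : ∀ x, g₁ x ≤ C)
    (hg₂C : ∀ x, g₂ x ≤ C) (hhC : ∀ x, h x ≤ C) (hC1 : 1 ≤ C) (hh : Monotone h)
    (hcross : ∀ x y, g₁ x * g₂ y ≤ g₁ (x ⊓ y) * g₂ (x ⊔ y)) :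
    (∫ x, g₁ x * h x ∂μ) * (∫ x, g₂ x ∂μ) ≤ (∫ x, g₁ x ∂μ) * (∫ x, g₂ x * h x ∂μ) := by
  classical
  exact holley_integral_of_fiber μ (fun _ σ => glue J (J.restrict σ) .plus) (fun _ => measurable_glue_restrict J)
    (fun _ => glue_restrict_inf J) (fun _ => glue_restrict_sup J) (fun _ => finite_range_glue_restrict J)
    (fun _ => hμ.fiber_glue_restrict_mul_le μ J) hg₁0 hg₂0 hh0 hg₁m hg₂m hhm hg₁C hg₂C hhC hC1
    (Eventually.of_forall fun σ => by simp only [apply_glue_restrict_of_dependsOn hg₁d]; exact tendsto_const_nhds)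
    (Eventually.of_forall fun σ => by simp only [apply_glue_restrict_of_dependsOn hg₂d]; exact tendsto_const_nhds)
    (Eventually.of_forall fun σ => by simp only [apply_glue_restrict_of_dependsOn hhd]; exact tendsto_const_nhds)
    hh hcross

variable [Infinite ι]

/-- **Holley's inequality with local weights against EVERY bounded measurable increasing functional** of the
infinite configuration (`ι` countably infinite, `μ` a box-TP₂ probability measure): `g₁, g₂` local, nonnegative,
bounded, with the cross condition; `h ≥ 0` bounded measurable increasing, NOT necessarily local.  Proof: local
increasing approximants `h_N → h` a.e. (`IsBoxTP2.exists_local_monotone_tendsto_ae`), the local inequality,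
dominated convergence. [this work] -/
theorem IsBoxTP2.holley_integral_spinConfig (μ : Measure (ι → ℤˣ)) [IsProbabilityMeasure μ] (hμ : IsBoxTP2 μ)
    (Λ : Finset ι) {g₁ g₂ h : (ι → ℤˣ) → ℝ} (hg₁d : DependsOn g₁ (↑Λ : Set ι)) (hg₂d : DependsOn g₂ (↑Λ : Set ι))
    (hg₁0 : ∀ x, 0 ≤ g₁ x) (hg₂0 : ∀ x, 0 ≤ g₂ x) (hh0 : ∀ x, 0 ≤ h x) (hg₁m : Measurable g₁)
    (hg₂m : Measurable g₂) (hhm : Measurable h) {C : ℝ} (hg₁C : ∀ x, g₁ x ≤ C) (hg₂C : ∀ x, g₂ x ≤ C)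
    (hhC : ∀ x, h x ≤ C) (hC1 : 1 ≤ C) (hh : Monotone h) (hcross : ∀ x y, g₁ x * g₂ y ≤ g₁ (x ⊓ y) * g₂ (x ⊔ y)) :
    (∫ x, g₁ x * h x ∂μ) * (∫ x, g₂ x ∂μ) ≤ (∫ x, g₁ x ∂μ) * (∫ x, g₂ x * h x ∂μ) := by
  classical
  obtain ⟨J₀, hJ₀m, hJ₀⟩ := exists_finset_exhaustion (ι := ι)
  set J : ℕ → Finset ι := fun N => J₀ N ∪ Λ with hJdef
  have hJm : Monotone J := fun N M hNM => Finset.union_subset_union (hJ₀m hNM) le_rfl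
  have hJ : ∀ v, ∃ N, v ∈ J N := fun v => by
    obtain ⟨N, hN⟩ := hJ₀ v
    exact ⟨N, Finset.mem_union_left _ hN⟩
  have hΛJ : ∀ N, (↑Λ : Set ι) ⊆ ↑(J N) := fun N => Finset.coe_subset.2 Finset.subset_union_right
  obtain ⟨k, hkd, hkmono, hkm, hk0, hkC, hklim⟩ :=
    hμ.exists_local_monotone_tendsto_ae μ hJm hJ hh hhm hh0 hhC
  -- the local inequality for every `N`
  have hN : ∀ N, (∫ x, g₁ x * k N x ∂μ) * (∫ x, g₂ x ∂μ) ≤ (∫ x, g₁ x ∂μ) * (∫ x, g₂ x * k N x ∂μ) :=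
    fun N => hμ.holley_integral_local μ (J N) (hg₁d.mono (hΛJ N)) (hg₂d.mono (hΛJ N)) (hkd N) hg₁0 hg₂0
      (hk0 N) hg₁m hg₂m (hkm N) hg₁C hg₂C (hkC N) hC1 (hkmono N) hcross
  -- dominated convergence
  have hlim : ∀ {g : (ι → ℤˣ) → ℝ}, (∀ x, 0 ≤ g x) → Measurable g → (∀ x, g x ≤ C) →
      Tendsto (fun N => ∫ x, g x * k N x ∂μ) atTop (𝓝 (∫ x, g x * h x ∂μ)) := by
    intro g hg0' hgm' hgC'
    refine tendsto_integral_of_dominated_convergence (fun _ => C * C) (fun N => ?_) (integrable_const _)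
      (fun N => Eventually.of_forall fun x => ?_) ?_
    · exact (hgm'.mul (hkm N)).aestronglyMeasurable
    · rw [Real.norm_eq_abs, abs_of_nonneg (mul_nonneg (hg0' x) (hk0 N x))]
      exact mul_le_mul (hgC' x) (hkC N x) (hk0 N x) ((hg0' x).trans (hgC' x))
    · filter_upwards [hklim] with x hx
      exact hx.const_mul (g x)
  exact le_of_tendsto_of_tendsto' ((hlim hg₁0 hg₁m hg₁C).mul tendsto_const_nhds)
    (tendsto_const_nhds.mul (hlim hg₂0 hg₂m hg₂C)) hN

/-- **Holley's inequality with local weights, events**: for every measurable increasing event `U` of the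
infinite configuration, `(∫_U g₁ dμ)(∫ g₂ dμ) ≤ (∫ g₁ dμ)(∫_U g₂ dμ)` — the normalised tilts satisfy
`(g₁μ)(U)/Z₁ ≤ (g₂μ)(U)/Z₂`. [this work] -/
theorem IsBoxTP2.holley_upperSet_spinConfig (μ : Measure (ι → ℤˣ)) [IsProbabilityMeasure μ] (hμ : IsBoxTP2 μ)
    (Λ : Finset ι) {g₁ g₂ : (ι → ℤˣ) → ℝ} (hg₁d : DependsOn g₁ (↑Λ : Set ι)) (hg₂d : DependsOn g₂ (↑Λ : Set ι))
    (hg₁0 : ∀ x, 0 ≤ g₁ x) (hg₂0 : ∀ x, 0 ≤ g₂ x) (hg₁m : Measurable g₁) (hg₂m : Measurable g₂) {C : ℝ}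
    (hg₁C : ∀ x, g₁ x ≤ C) (hg₂C : ∀ x, g₂ x ≤ C) (hC1 : 1 ≤ C)
    (hcross : ∀ x y, g₁ x * g₂ y ≤ g₁ (x ⊓ y) * g₂ (x ⊔ y)) {U : Set (ι → ℤˣ)} (hU : IsUpperSet U)
    (hUm : MeasurableSet U) :
    (∫ x in U, g₁ x ∂μ) * (∫ x, g₂ x ∂μ) ≤ (∫ x, g₁ x ∂μ) * (∫ x in U, g₂ x ∂μ) := by
  classical
  have hind : ∀ x, 0 ≤ U.indicator (1 : (ι → ℤˣ) → ℝ) x ∧ U.indicator (1 : (ι → ℤˣ) → ℝ) x ≤ 1 := fun x => by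
    by_cases hx : x ∈ U
    · simp [indicator_of_mem hx]
    · simp [indicator_of_notMem hx]
  have key := hμ.holley_integral_spinConfig μ Λ hg₁d hg₂d hg₁0 hg₂0 (fun x => (hind x).1) hg₁m hg₂m
    (measurable_one.indicator hUm) hg₁C hg₂C (fun x => (hind x).2.trans hC1) hC1
    (Literature.Probability.Percolation.KNPreFKG.monotone_indicator_one_of_isUpperSet hU) hcross
  have e : ∀ g : (ι → ℤˣ) → ℝ, (fun x => g x * U.indicator (1 : (ι → ℤˣ) → ℝ) x) = U.indicator g := fun g => by
    funext x
    by_cases hx : x ∈ U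
    · simp [indicator_of_mem hx]
    · simp [indicator_of_notMem hx]
  simp only [e, integral_indicator hUm] at key
  exact key

end Holley

/-! ### Holley's theorem for local Gibbs modifications of a box-TP₂ law -/

section Gibbs

variable {ι : Type*} [Countable ι] [Infinite ι]

/-- **HOLLEY'S THEOREM FOR LOCAL GIBBS MODIFICATIONS OF A BOX-TP₂ SPIN LAW** (`ι` countably infinite, `μ` a
box-TP₂ probability measure on `{−1,+1}^ι`, e.g. an infinite-volume Ising state): for local energies `H₁, H₂`
(depending on a finite `Λ`) with Holley's condition `H₁(σ ∧ τ) + H₂(σ ∨ τ) ≤ H₁(σ) + H₂(τ)`, the perturbed laws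
are stochastically ordered: `(∫ e^{−H₁} f dμ)(∫ e^{−H₂} dμ) ≤ (∫ e^{−H₁} dμ)(∫ e^{−H₂} f dμ)`, i.e.
`⟨f⟩_{H₁} ≤ ⟨f⟩_{H₂}`, for EVERY bounded measurable increasing `f` of the infinite configuration. [this work] -/
theorem IsBoxTP2.gibbs_holley_spinConfig (μ : Measure (ι → ℤˣ)) [IsProbabilityMeasure μ] (hμ : IsBoxTP2 μ)
    (Λ : Finset ι) {H₁ H₂ : (ι → ℤˣ) → ℝ} (hH₁ : DependsOn H₁ (↑Λ : Set ι)) (hH₂ : DependsOn H₂ (↑Λ : Set ι))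
    (hHolley : ∀ σ τ, H₁ (σ ⊓ τ) + H₂ (σ ⊔ τ) ≤ H₁ σ + H₂ τ) {f : (ι → ℤˣ) → ℝ} (hfm : Measurable f)
    (hf : Monotone f) {B : ℝ} (hfB : ∀ σ, |f σ| ≤ B) :
    (∫ σ, Real.exp (-H₁ σ) * f σ ∂μ) * (∫ σ, Real.exp (-H₂ σ) ∂μ) ≤
      (∫ σ, Real.exp (-H₁ σ) ∂μ) * (∫ σ, Real.exp (-H₂ σ) * f σ ∂μ) := by
  obtain ⟨M₁, hM₁⟩ := exists_abs_le_of_dependsOn hH₁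
  obtain ⟨M₂, hM₂⟩ := exists_abs_le_of_dependsOn hH₂
  -- common bound `C = exp(max M₁ M₂) + B + 1 ≥ 1`
  set C : ℝ := Real.exp (max M₁ M₂) + (B + B + 1) with hC
  have hB0 : 0 ≤ B := (abs_nonneg _).trans (hfB 1)
  have hC1 : 1 ≤ C := by
    have := Real.exp_pos (max M₁ M₂)
    rw [hC]; linarith
  have hexpC : ∀ {H : (ι → ℤˣ) → ℝ} {M : ℝ}, (∀ σ, |H σ| ≤ M) → M ≤ max M₁ M₂ → ∀ σ, Real.exp (-H σ) ≤ C := by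
    intro H M hM hMle σ
    have h1 : Real.exp (-H σ) ≤ Real.exp (max M₁ M₂) :=
      Real.exp_le_exp.2 ((neg_le_abs (H σ)).trans ((hM σ).trans hMle))
    rw [hC]; linarith
  -- shift `f` to be nonnegative: `f + B`
  have key := hμ.holley_integral_spinConfig μ Λ (g₁ := fun σ => Real.exp (-H₁ σ))
    (g₂ := fun σ => Real.exp (-H₂ σ)) (h := fun σ => f σ + B)
    (fun σ τ hστ => by simp only [hH₁ hστ]) (fun σ τ hστ => by simp only [hH₂ hστ])
    (fun σ => (Real.exp_pos _).le) (fun σ => (Real.exp_pos _).le)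
    (fun σ => by have := hfB σ; rw [abs_le] at this; linarith [this.1])
    ((measurable_of_dependsOn hH₁).neg.exp) ((measurable_of_dependsOn hH₂).neg.exp) (hfm.add_const B)
    (C := C) (hexpC hM₁ (le_max_left _ _)) (hexpC hM₂ (le_max_right _ _))
    (fun σ => by have := hfB σ; rw [abs_le] at this; rw [hC]; linarith [this.2, Real.exp_pos (max M₁ M₂)]) hC1
    (fun σ τ hστ => by simp only; linarith [hf hστ])
    (fun σ τ => by
      simp only [← Real.exp_add]
      exact Real.exp_le_exp.2 (by linarith [hHolley σ τ]))
  -- remove the shift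
  have hi : ∀ {H : (ι → ℤˣ) → ℝ} {M : ℝ}, (∀ σ, |H σ| ≤ M) → DependsOn H (↑Λ : Set ι) →
      Integrable (fun σ => Real.exp (-H σ)) μ := fun {H M} hM hH =>
    Integrable.of_bound ((measurable_of_dependsOn hH).neg.exp.aestronglyMeasurable) (Real.exp M)
      (Eventually.of_forall fun σ => by
        rw [Real.norm_eq_abs, abs_of_pos (Real.exp_pos _)]
        exact Real.exp_le_exp.2 ((neg_le_abs (H σ)).trans (hM σ)))
  have hif : ∀ {H : (ι → ℤˣ) → ℝ} {M : ℝ}, (∀ σ, |H σ| ≤ M) → DependsOn H (↑Λ : Set ι) →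
      Integrable (fun σ => Real.exp (-H σ) * f σ) μ := fun {H M} hM hH =>
    Integrable.of_bound (((measurable_of_dependsOn hH).neg.exp.mul hfm).aestronglyMeasurable) (Real.exp M * B)
      (Eventually.of_forall fun σ => by
        rw [Real.norm_eq_abs, abs_mul, abs_of_pos (Real.exp_pos _)]
        exact mul_le_mul (Real.exp_le_exp.2 ((neg_le_abs (H σ)).trans (hM σ))) (hfB σ) (abs_nonneg _)
          (Real.exp_pos _).le)
  have e1 : ∫ σ, Real.exp (-H₁ σ) * (f σ + B) ∂μ =
      ∫ σ, Real.exp (-H₁ σ) * f σ ∂μ + B * ∫ σ, Real.exp (-H₁ σ) ∂μ := by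
    simp only [mul_add]
    rw [integral_add (hif hM₁ hH₁) ((hi hM₁ hH₁).mul_const B), integral_mul_const, mul_comm _ B]
  have e2 : ∫ σ, Real.exp (-H₂ σ) * (f σ + B) ∂μ =
      ∫ σ, Real.exp (-H₂ σ) * f σ ∂μ + B * ∫ σ, Real.exp (-H₂ σ) ∂μ := by
    simp only [mul_add]
    rw [integral_add (hif hM₂ hH₂) ((hi hM₂ hH₂).mul_const B), integral_mul_const, mul_comm _ B]
  rw [e1, e2] at key
  nlinarith [key]

/-- **The perturbed state increases with the field**: for a submodular local energy `H`
(`H(σ ∧ τ) + H(σ ∨ τ) ≤ H(σ) + H(τ)`) and an increasing local term `m`, the laws `e^{−H}μ/Z` and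
`e^{−(H−m)}μ/Z'` are stochastically ordered: `⟨f⟩_H ≤ ⟨f⟩_{H−m}` for every bounded measurable increasing `f`.
[this work] -/
theorem IsBoxTP2.gibbs_field_mono_spinConfig (μ : Measure (ι → ℤˣ)) [IsProbabilityMeasure μ] (hμ : IsBoxTP2 μ)
    (Λ : Finset ι) {H m : (ι → ℤˣ) → ℝ} (hH : DependsOn H (↑Λ : Set ι)) (hmd : DependsOn m (↑Λ : Set ι))
    (hsub : ∀ σ τ, H (σ ⊓ τ) + H (σ ⊔ τ) ≤ H σ + H τ) (hm : Monotone m) {f : (ι → ℤˣ) → ℝ}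
    (hfm : Measurable f) (hf : Monotone f) {B : ℝ} (hfB : ∀ σ, |f σ| ≤ B) :
    (∫ σ, Real.exp (-H σ) * f σ ∂μ) * (∫ σ, Real.exp (-(H σ - m σ)) ∂μ) ≤
      (∫ σ, Real.exp (-H σ) ∂μ) * (∫ σ, Real.exp (-(H σ - m σ)) * f σ ∂μ) :=
  hμ.gibbs_holley_spinConfig μ Λ hH (fun σ τ hστ => by simp only [hH hστ, hmd hστ]) (fun σ τ => by
    linarith [hsub σ τ, hm (le_sup_right : τ ≤ σ ⊔ τ)]) hfm hf hfB

end Gibbs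

/-! ### The Ising states on `ℤ^d` -/

section Ising

variable {d : ℕ} [NeZero d] {β h : ℝ}

/-- **HOLLEY'S THEOREM FOR LOCAL PERTURBATIONS OF THE PLUS STATE** (`d ≥ 1`, `β ≥ 0`, any `h`): for every
probability measure on `{−1,+1}^{ℤ^d}` with the plus correlations and local energies `H₁, H₂` satisfying Holley's
condition, `(∫ e^{−H₁} f dμ⁺)(∫ e^{−H₂} dμ⁺) ≤ (∫ e^{−H₁} dμ⁺)(∫ e^{−H₂} f dμ⁺)` for every bounded measurable
increasing `f` — the perturbed states are stochastically ordered. [this work] -/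
theorem plusState_gibbs_holley (hβ : 0 ≤ β) (μ : Measure (SpinConfig (Site d))) [IsProbabilityMeasure μ]
    (hμ : ∀ B : Finset (Site d), spinCorr μ B = plusCorr d β h B) (Λ : Finset (Site d))
    {H₁ H₂ : SpinConfig (Site d) → ℝ} (hH₁ : DependsOn H₁ (↑Λ : Set (Site d)))
    (hH₂ : DependsOn H₂ (↑Λ : Set (Site d))) (hHolley : ∀ σ τ, H₁ (σ ⊓ τ) + H₂ (σ ⊔ τ) ≤ H₁ σ + H₂ τ)
    {f : SpinConfig (Site d) → ℝ} (hfm : Measurable f) (hf : Monotone f) {B : ℝ} (hfB : ∀ σ, |f σ| ≤ B) :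
    (∫ σ, Real.exp (-H₁ σ) * f σ ∂μ) * (∫ σ, Real.exp (-H₂ σ) ∂μ) ≤
      (∫ σ, Real.exp (-H₁ σ) ∂μ) * (∫ σ, Real.exp (-H₂ σ) * f σ ∂μ) := by
  haveI : Infinite (Site d) := infinite_site_of_neZero
  exact IsBoxTP2.gibbs_holley_spinConfig μ (isBoxTP2_of_forall_spinCorr_eq_plusCorr hβ μ hμ) Λ hH₁ hH₂ hHolley
    hfm hf hfB

/-- Holley's theorem for local perturbations of the MINUS STATE (`β ≥ 0`, any `h`). [this work] -/
theorem minusState_gibbs_holley (hβ : 0 ≤ β) (μ : Measure (SpinConfig (Site d))) [IsProbabilityMeasure μ]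
    (hμ : ∀ B : Finset (Site d), spinCorr μ B = minusCorr d β h B) (Λ : Finset (Site d))
    {H₁ H₂ : SpinConfig (Site d) → ℝ} (hH₁ : DependsOn H₁ (↑Λ : Set (Site d)))
    (hH₂ : DependsOn H₂ (↑Λ : Set (Site d))) (hHolley : ∀ σ τ, H₁ (σ ⊓ τ) + H₂ (σ ⊔ τ) ≤ H₁ σ + H₂ τ)
    {f : SpinConfig (Site d) → ℝ} (hfm : Measurable f) (hf : Monotone f) {B : ℝ} (hfB : ∀ σ, |f σ| ≤ B) :
    (∫ σ, Real.exp (-H₁ σ) * f σ ∂μ) * (∫ σ, Real.exp (-H₂ σ) ∂μ) ≤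
      (∫ σ, Real.exp (-H₁ σ) ∂μ) * (∫ σ, Real.exp (-H₂ σ) * f σ ∂μ) := by
  haveI : Infinite (Site d) := infinite_site_of_neZero
  exact IsBoxTP2.gibbs_holley_spinConfig μ (isBoxTP2_of_forall_spinCorr_eq_minusCorr hβ μ hμ) Λ hH₁ hH₂ hHolley
    hfm hf hfB

/-- Holley's theorem for local perturbations of the FREE STATE (`β ≥ 0`, `h ≥ 0`). [this work] -/
theorem freeState_gibbs_holley (hβ : 0 ≤ β) (hh : 0 ≤ h) (μ : Measure (SpinConfig (Site d)))
    [IsProbabilityMeasure μ] (hμ : ∀ B : Finset (Site d), spinCorr μ B = freeCorr d β h B) (Λ : Finset (Site d))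
    {H₁ H₂ : SpinConfig (Site d) → ℝ} (hH₁ : DependsOn H₁ (↑Λ : Set (Site d)))
    (hH₂ : DependsOn H₂ (↑Λ : Set (Site d))) (hHolley : ∀ σ τ, H₁ (σ ⊓ τ) + H₂ (σ ⊔ τ) ≤ H₁ σ + H₂ τ)
    {f : SpinConfig (Site d) → ℝ} (hfm : Measurable f) (hf : Monotone f) {B : ℝ} (hfB : ∀ σ, |f σ| ≤ B) :
    (∫ σ, Real.exp (-H₁ σ) * f σ ∂μ) * (∫ σ, Real.exp (-H₂ σ) ∂μ) ≤
      (∫ σ, Real.exp (-H₁ σ) ∂μ) * (∫ σ, Real.exp (-H₂ σ) * f σ ∂μ) := by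
  haveI : Infinite (Site d) := infinite_site_of_neZero
  exact IsBoxTP2.gibbs_holley_spinConfig μ (isBoxTP2_of_forall_spinCorr_eq_freeCorr hβ hh μ hμ) Λ hH₁ hH₂
    hHolley hfm hf hfB

end Ising

end Summit.CriticalPhenomena.PercolationContinuityZ3.Theorems.SahiBoxTP2
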